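import Summits.QuantumFields.YangMills.Theorems.BalabanLadderIRDefectSquaringSharpExtension
import HarnessLib

/-!
# DECOMP probe (lens «decomp», seat ym-ir-idea-25 g2): the transverse-channel re-cut of per-box purity is an
# EQUIVALENT re-cut — kernel certificate of a NULL

HONEST LABEL.  Elementary spectral bookkeeping over the abstract class `IsAxisSymmetric ∧ IsTracePositive`
(EVERY compact gauge group at EVERY `β ≥ 0`, `U(1)` and `SO(3)` included); it carries no Yang–Mills content.
`IRcof` / `IR` / `PXcof` / `N_cof` stay 0/1; the Clay YM mass gap is NOT proved.  This file is NOT a line: it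
registers nothing, touches no slot, and certifies the null booked in `DECOMP-CENSUS-ym-ir-idea-25-g2.md`.

THE CANDIDATE CUT (the one cut of the g2 sweep outside the desk's eleven axes at first sight).  Read the `4:1`
box `L³ × τ` along a LONG side instead of the short one: `Z(L,L,L,τ) = Z(τ,L,L,L) = tr S_τ^L` (`[Sym] (0 3)`),
`S_τ` the transfer matrix of the thermal slab `τ × L × L`.  With `φ(Z τ L L) = log ‖S_τ‖` and the transposed
excitation `Y_L(τ,L,L) := Yfun (Z τ L L) L = log (tr S_τ^L / ‖S_τ‖^L) ≥ 0` one has the identity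
  `−log (1 − δ^{(t)}(L)) = L·s + 2·Y_L(t,L,L) − Y_L(2t,L,L)`,   `s := 2 φ(Z t L L) − φ(Z (2t) L L) ≥ 0`,
where `s` is the CASIMIR SLOPE of the tree's `slope_le_Yfun` (`= E₀(2t,L,L) − 2E₀(t,L,L)`: "no Casimir force
across the thermal slab") and `Y_L(t,L,L)` is "vacuum dominance of the thin slab in the long direction".
Candidate split of the purity half of the slot (`PinnedExitsCofinalAt (1/24)`), per box:
  σ₁ `L·s ≤ ε₁`  ∧  σ₂ `Y_L(t,L,L) ≤ ε₂`  ⟹  `δ^{(t)}(L) ≤ ε₁ + 2ε₂`                              (P0 `seam`).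

THE VERDICT (kernel-checked here).  Both halves are CONSEQUENCES of purity of the SAME box:
  P1 `transExc_le_thermal` : `Y_L(t,L,L) ≤ Y_t(L,L,L)`        (`2 ≤ t ≤ L`; ℓᵖ-monotonicity + the φ-sandwich:
                               reading a box along a longer side is purer),
  P2 `slope_le_thermal`    : `L·s ≤ (2L/(L−t))·Y_t(L,L,L)`   (`2 ≤ t < L`; `slope_bound` + `extension_sharp`,
                               the junk term `Y_2(2t,L,L)/m` sent to `0` along `m → ∞`),
and `Y_t(L,L,L) ≤ x_t ≤ 2δ^{(t)}(L)` once `δ^{(t)}(L) ≤ 1/2` (`aspectDefect_facts`, `Yfun_le_exc`).  Hence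
  σ₁(ε₁) ∧ σ₂(ε₂) ⟹ δ ≤ ε₁ + 2ε₂     and     δ ≤ η ≤ 1/2 ⟹ σ₁((4L/(L−t))·η) ∧ σ₂(2η)      (`wilson_recut`):
the cut is an EQUIVALENT re-cut of `E`'s per-box content in the aspect bootstrap's own transposed coordinates
(`extension_step`, `termwise`, `slope_le_Yfun` already NAME both summands) — census axis 2 (rows 15/18/30,
B-g4-1) × the row-21 pattern (`E ⇔ F ∧ V`) without row 21's new object; neither half is easier than `E` by a
named tool; both fail for `U(1)₄` (σ₁: photon Casimir slope; σ₂: torons `e^{−g²n²/8}`).  NULL.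

References: tree `slope_bound`, `extension_step`, `extension_sharp`, `slope_le_Yfun`, `aspectDefect_facts`,
`coldDefect_eq_aspectDefect`, `axisSymmetric`, `tracePositive`; Luscher1977, PrivmanFisher1983.
-/

noncomputable section
open Filter
open scoped Topology
open Literature.MathematicalPhysics.QuantumFieldTheory Literature.MathematicalPhysics.QuantumLattice
open Summit.QuantumFields.YangMills.Cruxes.IR.AspectBootstrap
open Summit.QuantumFields.YangMills.Cruxes.IR.ColdPurityBridge (coldDefect)

namespace Summit.QuantumFields.YangMills.Cruxes.IRcof.DecompProbeTransverse

/-- The Casimir slope of the slab pair `t → 2t` with cross-section `L × L` (short side in slot 0):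
`s = 2 φ(Z t L L) − φ(Z (2t) L L)` (`= E₀(2t,L,L) − 2 E₀(t,L,L)` in the long-side quantisation). -/
def casimirSlope (Z : ℕ → ℕ → ℕ → ℕ → ℝ) (L t : ℕ) : ℝ := 2 * phi (Z t L L) - phi (Z (2 * t) L L)

/-- The transposed excitation of the thin slab `t × L × L` over length `L`: `Y_L(t,L,L) = Yfun (Z t L L) L`. -/
def transExc (Z : ℕ → ℕ → ℕ → ℕ → ℝ) (L t : ℕ) : ℝ := Yfun (Z t L L) L

section Family

variable {Z : ℕ → ℕ → ℕ → ℕ → ℝ}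

/-- `x ≤ C/(m+2)` for all large `m` forces `x ≤ 0`. -/
private theorem nonpos_of_forall_le_div {x C : ℝ} (m₀ : ℕ)
    (h : ∀ m : ℕ, m₀ ≤ m → x ≤ C / ((m : ℝ) + 2)) : x ≤ 0 := by
  by_contra hx'
  have hx : 0 < x := not_le.mp hx'
  obtain ⟨n, hn⟩ := exists_nat_gt (C / x)
  have hm := h (max m₀ n) (le_max_left _ _)
  have hpos : (0 : ℝ) < ((max m₀ n : ℕ) : ℝ) + 2 := by positivity
  rw [le_div_iff₀ hpos] at hm
  have hn' : C / x < ((max m₀ n : ℕ) : ℝ) + 2 := by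
    have : (n : ℝ) ≤ ((max m₀ n : ℕ) : ℝ) := by exact_mod_cast le_max_right m₀ n
    linarith
  rw [div_lt_iff₀ hx] at hn'
  linarith [mul_comm x (((max m₀ n : ℕ) : ℝ) + 2)]

/-- **P0 (the seam).** `δ^{(t)}(L) ≤ L·s + 2·Y_L(t,L,L)` for `2 ≤ L`, `2 ≤ t`: the only input beyond the
definitions is `Y_L(2t,L,L) ≥ 0` and `e^u ≥ 1 + u`. -/
theorem seam (hS : IsAxisSymmetric Z) (hT : IsTracePositive Z) {L t : ℕ} (hL : 2 ≤ L) (ht : 2 ≤ t) :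
    aspectDefect Z L t ≤ (L : ℝ) * casimirSlope Z L t + 2 * transExc Z L t := by
  obtain ⟨l, rfl⟩ : ∃ l, L = l + 2 := ⟨L - 2, by omega⟩
  have hd1 : HasSpectralDatum (Z t (l + 2) (l + 2)) := hT _ _ _ ht hL hL
  have hd2 : HasSpectralDatum (Z (2 * t) (l + 2) (l + 2)) := hT _ _ _ (by omega) hL hL
  have hz1 : 0 < Z t (l + 2) (l + 2) (l + 2) := z_pos hd1 l
  have hz2 : 0 < Z (2 * t) (l + 2) (l + 2) (l + 2) := z_pos hd2 l
  have hY2 : 0 ≤ Yfun (Z (2 * t) (l + 2) (l + 2)) (l + 2) := Yfun_nonneg hd2 l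
  have e1 : Z (l + 2) (l + 2) (l + 2) t = Z t (l + 2) (l + 2) (l + 2) := (hS _ _ _ _).1
  have e2 : Z (l + 2) (l + 2) (l + 2) (2 * t) = Z (2 * t) (l + 2) (l + 2) (l + 2) := (hS _ _ _ _).1
  have hYA : Real.log (Z t (l + 2) (l + 2) (l + 2)) =
      ((l + 2 : ℕ) : ℝ) * phi (Z t (l + 2) (l + 2)) + Yfun (Z t (l + 2) (l + 2)) (l + 2) := by
    unfold Yfun; ring
  have hYB : Real.log (Z (2 * t) (l + 2) (l + 2) (l + 2)) =
      ((l + 2 : ℕ) : ℝ) * phi (Z (2 * t) (l + 2) (l + 2)) + Yfun (Z (2 * t) (l + 2) (l + 2)) (l + 2) := by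
    unfold Yfun; ring
  unfold aspectDefect casimirSlope transExc
  rw [e2, e1]
  have hlogsq : Real.log (Z t (l + 2) (l + 2) (l + 2) ^ 2) = 2 * Real.log (Z t (l + 2) (l + 2) (l + 2)) := by
    rw [Real.log_pow]; norm_num
  have hexp : Z (2 * t) (l + 2) (l + 2) (l + 2) / Z t (l + 2) (l + 2) (l + 2) ^ 2 =
      Real.exp (Real.log (Z (2 * t) (l + 2) (l + 2) (l + 2)) - 2 * Real.log (Z t (l + 2) (l + 2) (l + 2))) := by
    rw [← hlogsq, Real.exp_sub, Real.exp_log hz2, Real.exp_log (pow_pos hz1 2)]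
  rw [hexp]
  set D := Real.log (Z (2 * t) (l + 2) (l + 2) (l + 2)) - 2 * Real.log (Z t (l + 2) (l + 2) (l + 2)) with hD
  have hlow : -(((l + 2 : ℕ) : ℝ) * (2 * phi (Z t (l + 2) (l + 2)) - phi (Z (2 * t) (l + 2) (l + 2))) +
      2 * Yfun (Z t (l + 2) (l + 2)) (l + 2)) ≤ D := by
    rw [hD, hYA, hYB]
    nlinarith [hY2]
  have hex := Real.add_one_le_exp D
  linarith

/-- **P1.  Transposed excitation ≤ thermal excitation**: `Y_L(t,L,L) ≤ Y_t(L,L,L)` for `2 ≤ t ≤ L` — reading the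
box `L³ × t` along a long side is purer than along the short one.  Proof: for every `m`,
`t·(m φ(Z L L L)) ≤ t·log Z(L,L,L,m) = t·log Z(m,L,L,L) ≤ L·log Z(m,L,L,t) = L·log Z(t,L,L,m) ≤ L·(m φ(Z t L L) + Y_2)`
(sandwich, `[Sym]`, ℓᵖ-monotonicity in the last slot, `[Sym]`, sandwich), then `m → ∞`. -/
theorem transExc_le_thermal (hS : IsAxisSymmetric Z) (hT : IsTracePositive Z) {L t : ℕ} (ht : 2 ≤ t)
    (htL : t ≤ L) : transExc Z L t ≤ Yfun (Z L L L) t := by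
  obtain ⟨k, rfl⟩ : ∃ k, t = k + 2 := ⟨t - 2, by omega⟩
  obtain ⟨l, rfl⟩ : ∃ l, L = l + 2 := ⟨L - 2, by omega⟩
  have hL : 2 ≤ l + 2 := by omega
  have hdc : HasSpectralDatum (Z (l + 2) (l + 2) (l + 2)) := hT _ _ _ hL hL hL
  have hds : HasSpectralDatum (Z (k + 2) (l + 2) (l + 2)) := hT _ _ _ ht hL hL
  have hΔ : ((k + 2 : ℕ) : ℝ) * phi (Z (l + 2) (l + 2) (l + 2)) -
      ((l + 2 : ℕ) : ℝ) * phi (Z (k + 2) (l + 2) (l + 2)) ≤ 0 := by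
    apply nonpos_of_forall_le_div (C := ((l + 2 : ℕ) : ℝ) * Yfun (Z (k + 2) (l + 2) (l + 2)) 2) 0
    intro m _
    have hdm : HasSpectralDatum (Z (m + 2) (l + 2) (l + 2)) := hT _ _ _ (by omega) hL hL
    have a1 := mul_phi_le_log hdc m
    have b1 : Z (l + 2) (l + 2) (l + 2) (m + 2) = Z (m + 2) (l + 2) (l + 2) (l + 2) := (hS _ _ _ _).1
    have c1 := mul_log_le hdm (show k ≤ l by omega)
    have d1 : Z (m + 2) (l + 2) (l + 2) (k + 2) = Z (k + 2) (l + 2) (l + 2) (m + 2) := (hS _ _ _ _).1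
    have f1 := log_le_mul_phi_add hds m
    rw [b1] at a1
    rw [d1] at c1
    have hm2 : (0 : ℝ) < (m : ℝ) + 2 := by positivity
    rw [le_div_iff₀ hm2]
    have ht0 : (0 : ℝ) ≤ ((k + 2 : ℕ) : ℝ) := by positivity
    have hl0 : (0 : ℝ) ≤ ((l + 2 : ℕ) : ℝ) := by positivity
    have a2 := mul_le_mul_of_nonneg_left a1 ht0
    have f2 := mul_le_mul_of_nonneg_left f1 hl0
    push_cast at a2 c1 f2 ⊢
    nlinarith [a2, c1, f2]
  have e1 : Z (k + 2) (l + 2) (l + 2) (l + 2) = Z (l + 2) (l + 2) (l + 2) (k + 2) := (hS _ _ _ _).1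
  unfold transExc Yfun
  rw [e1]
  push_cast at hΔ ⊢
  linarith

/-- **P2.  Casimir slope ≤ thermal excitation of the cube**: `L·s ≤ (2L/(L−t))·Y_t(L,L,L)` for `2 ≤ t < L`.
Proof: `slope_bound` at transposed time `m` gives `m·s ≤ 2·Y_t(m,L,L) + Y_2(2t,L,L)`, `extension_sharp` gives
`Y_t(m,L,L) ≤ (m/(L−t))·Y_t(L,L,L)`; divide by `m` and let `m → ∞`. -/
theorem slope_le_thermal (hS : IsAxisSymmetric Z) (hT : IsTracePositive Z) {L t : ℕ} (ht : 2 ≤ t)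
    (htL : t < L) :
    (L : ℝ) * casimirSlope Z L t ≤ 2 * (L : ℝ) / ((L : ℝ) - t) * Yfun (Z L L L) t := by
  have hL : 2 ≤ L := by omega
  have hLt : (0 : ℝ) < (L : ℝ) - t := by
    have : (t : ℝ) < L := by exact_mod_cast htL
    linarith
  have ht0 : (t : ℝ) ≠ 0 := by
    have : (0 : ℝ) < t := by exact_mod_cast (show 0 < t by omega)
    exact this.ne'
  have hs : casimirSlope Z L t - 2 / ((L : ℝ) - t) * Yfun (Z L L L) t ≤ 0 := by
    apply nonpos_of_forall_le_div (C := Yfun (Z (2 * t) L L) 2) L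
    intro m hm
    have SB := slope_bound hS hT (b₁ := L) (b₂ := L) (τ := m + 2) (c := t) (n := t) (n' := 2 * t)
      hL hL (by omega) ht le_rfl (by omega)
    have ES := extension_sharp hS hT (b₁ := L) (b₂ := L) (c := t) (n := L) (n' := m + 2) hL hL ht htL
      (by omega)
    have h2t : ((2 * t : ℕ) : ℝ) / (t : ℝ) = 2 := by
      push_cast; field_simp
    rw [h2t] at SB
    unfold casimirSlope
    have hm2 : (0 : ℝ) < (m : ℝ) + 2 := by positivity
    rw [le_div_iff₀ hm2]
    have ES2 := mul_le_mul_of_nonneg_left ES (show (0 : ℝ) ≤ 2 by norm_num)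
    have e : 2 / ((L : ℝ) - t) * Yfun (Z L L L) t * ((m : ℝ) + 2) =
        2 * (((m + 2 : ℕ) : ℝ) / ((L : ℝ) - t) * Yfun (Z L L L) t) := by
      push_cast; field_simp
    push_cast at SB ES2 e ⊢
    nlinarith [SB, ES2, e]
  have hL0 : (0 : ℝ) ≤ (L : ℝ) := by positivity
  have h1 := mul_le_mul_of_nonneg_left hs hL0
  have e2 : (L : ℝ) * (2 / ((L : ℝ) - t) * Yfun (Z L L L) t) = 2 * (L : ℝ) / ((L : ℝ) - t) * Yfun (Z L L L) t := by
    field_simp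
  nlinarith [h1, e2]

/-- **P1 + P2 + `aspectDefect_facts`: purity of one box forces both halves of the cut (abstract class).**
For `2 ≤ t < L`: if `δ^{(t)}(L) ≤ η ≤ 1/2` then `Y_L(t,L,L) ≤ 2η` and `L·s ≤ (2L/(L−t))·2η`. -/
theorem halves_of_pure (hS : IsAxisSymmetric Z) (hT : IsTracePositive Z) {L t : ℕ} (ht : 2 ≤ t) (htL : t < L)
    {η : ℝ} (hη : η ≤ 1 / 2) (hδ : aspectDefect Z L t ≤ η) :
    transExc Z L t ≤ 2 * η ∧ (L : ℝ) * casimirSlope Z L t ≤ 2 * (L : ℝ) / ((L : ℝ) - t) * (2 * η) := by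
  have hL : 2 ≤ L := by omega
  obtain ⟨k, hk⟩ : ∃ k, t = k + 2 := ⟨t - 2, by omega⟩
  have F := aspectDefect_facts hT (L := L) (t := t) hL ht
  have hx : exc (Z L L L) t ≤ 2 * η := by
    have := F.2.2.2 (le_trans hδ hη)
    linarith
  have hYx : Yfun (Z L L L) t ≤ exc (Z L L L) t := by
    rw [hk]; exact Yfun_le_exc (hT L L L hL hL hL) k
  have hY : Yfun (Z L L L) t ≤ 2 * η := le_trans hYx hx
  refine ⟨le_trans (transExc_le_thermal hS hT ht htL.le) hY, le_trans (slope_le_thermal hS hT ht htL) ?_⟩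
  have hLt : (0 : ℝ) < (L : ℝ) - t := by
    have : (t : ℝ) < L := by exact_mod_cast htL
    linarith
  have hc : 0 ≤ 2 * (L : ℝ) / ((L : ℝ) - t) := by positivity
  exact mul_le_mul_of_nonneg_left hY hc

end Family

/-! ## The Wilson model: the transverse-channel cut of `coldDefect` is an equivalent re-cut of purity -/

section Model

variable {G : Type} [Group G] [TopologicalSpace G] [IsTopologicalGroup G] [CompactSpace G]
  [MeasurableSpace G] [BorelSpace G]

/-- **The verdict on the model** (every compact `G`, every lattice representation `r`, every `β ≥ 0`, `L ≥ 8`,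
`t = ⌊L/4⌋`, `Z = Z_{r,β}`): (i) the seam `δᶜ_β(L) ≤ L·s + 2·Y_L(t,L,L)`; (ii) `Y_L(t,L,L) ≤ Y_t(L,L,L)`;
(iii) `L·s ≤ (2L/(L−t))·Y_t(L,L,L)`; (iv) `δᶜ_β(L) ≤ η ≤ 1/2 ⇒ Y_L(t,L,L) ≤ 2η ∧ L·s ≤ (2L/(L−t))·2η`.
So `{σ₁ ∧ σ₂}` and `{δᶜ small}` are the same statement per box up to constants: no decomposition. -/
theorem wilson_recut (r : LatticeRep G) {β : ℝ} (hβ : 0 ≤ β) {L : ℕ} (hL : 8 ≤ L) :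
    (coldDefect r.ρ β L ≤ (L : ℝ) * casimirSlope (wilsonFinTorusPartition r.ρ β) L (L / 4) +
        2 * transExc (wilsonFinTorusPartition r.ρ β) L (L / 4)) ∧
    (transExc (wilsonFinTorusPartition r.ρ β) L (L / 4) ≤
        Yfun (wilsonFinTorusPartition r.ρ β L L L) (L / 4)) ∧
    ((L : ℝ) * casimirSlope (wilsonFinTorusPartition r.ρ β) L (L / 4) ≤
        2 * (L : ℝ) / ((L : ℝ) - (L / 4 : ℕ)) * Yfun (wilsonFinTorusPartition r.ρ β L L L) (L / 4)) ∧
    (∀ η : ℝ, η ≤ 1 / 2 → coldDefect r.ρ β L ≤ η →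
        transExc (wilsonFinTorusPartition r.ρ β) L (L / 4) ≤ 2 * η ∧
        (L : ℝ) * casimirSlope (wilsonFinTorusPartition r.ρ β) L (L / 4) ≤
          2 * (L : ℝ) / ((L : ℝ) - (L / 4 : ℕ)) * (2 * η)) := by
  have hS := axisSymmetric r β
  have hT := tracePositive r hβ
  have ht : 2 ≤ L / 4 := by omega
  have htL : L / 4 < L := by omega
  refine ⟨?_, transExc_le_thermal hS hT ht htL.le, slope_le_thermal hS hT ht htL, ?_⟩
  · rw [coldDefect_eq_aspectDefect]
    exact seam hS hT (by omega) ht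
  · intro η hη hδ
    rw [coldDefect_eq_aspectDefect] at hδ
    exact halves_of_pure hS hT ht htL hη hδ

end Model

end Summit.QuantumFields.YangMills.Cruxes.IRcof.DecompProbeTransverse

end
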